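import Summits.QuantumFields.BalabanUV.Beta.GAN24.InsertionWordVolumeLimit

/-!
# `BalabanUV.Beta.GAN24.BackgroundExpansionAllOrders` — binder row G-an2-4 ∕ (CONV-C), route R7 «TWO CURRENCIES», PART 160: THE BACKGROUND EXPANSION OF THE EFFECTIVE FORM TO ALL
# ORDERS.  Every DIAGRAM — a finite product, in any order and with any repetitions, of the letters `c_k⁻¹` (PART 143) and `X_{w,k} = L^{dk}Q_k(𝒢P(V_{i₁})𝒢⋯P(V_{i_n})𝒢)Q_kᴴ`
# (PART 159; `w` any word over a family `(V_i)` of Lipschitz backgrounds) — and every finite `ℂ`-linear combination of diagrams has the INPUT triple ((UD), (SR), EL₂) along the even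
# cubic volumes, hence the β-cell's whole `LimitRate` END on `ℤ^d`, MODULO ONLY the backgrounds' pointwise limits (EL₁).  Since `c_k(t) = L^{dk}Q_k(Δ_a + Σ_i t_iP(V_i))⁻¹Q_kᴴ` has
# `∂_w c_k|₀ = (−1)^{|w|}Σ_{orderings} X_{w,k}` (PART 122) and every mixed derivative of `t ↦ c_k(t)⁻¹` at `0` is a signed sum of diagrams `c⁻¹(∂c)c⁻¹(∂c)⋯c⁻¹` (Faà di Bruno for the
# inverse; PART 121 is order two), EVERY Taylor coefficient of the (1.65)-dictionary effective form `Σ_k(t) = c_k(t)⁻¹ − a″1` in the backgrounds is such a combination: PARTs 147 ∕ 157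
# ∕ 158 (orders one and two) become the first instances of ONE theorem.  §1 is the closure of the INPUT triple under finite products (`List.prod`, PART 156's `mul_inputs` by induction;
# the empty product is the identity tower) and finite linear combinations (`Finset.sum`, PART 130's linear rules); §2 reads the letters (PART 143 ∕ PART 159) and concludes with PART
# 140's generic END (unit b2b-balaban-gan24-p3, gen 56; v1)

NOT IN PRINT; OUR PROOF ([folklore] bookkeeping BY NAME over PART 156 (`mul_inputs`, `inputs_of_le_rate`), PART 159 (`wordInsertion_inputs`), PART 143 (`invCov_inputs`), PART 130 ∕ 127
(`entryDecay_add ∕ _smul ∕ _one`, `twoLevelDecayRate_add ∕ _smul ∕ _const`), PART 148 (`eventually_castT_eq_iff`), PART 140 (`conv_of_decay_of_tendsto`); [Balaban1987RG1] (1.21)–(1.22)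
p. 264 LOCATE the shapes; nothing printed is a hypothesis).
HONEST FRAMING (cell contract, verbatim): «discharging `BetaPertH` makes Bałaban's UV stability UNCONDITIONAL — a real constructive-QFT result; it is NOT the
continuum limit and NOT the Clay problem.»  HONEST DEPENDENCY (verbatim): «continuum YM on T⁴ ⇐ BetaPertH ∧ nine spine estimates (0/9 proved); BetaPertH ⇐
(D1) ∧ (D4) ∧ CAP+tail; G-an2-4 gates asym, D1 and NE2/3/4.»

WHAT THIS FILE PROVES (0 sorry, 0 `def`; a TOWER FAMILY is `X : (t : ℕ) → ℕ → Matrix (idx L (cubic d (side t)) 0) (idx L (cubic d (side t)) 0) ℂ`; «INPUTS of `X`» = `∃ κ > 0, B, B′ ≥ 0`: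
(UD) `EntryDecay distK (X_t k) B κ` ∀ t k, (SR) `TwoLevelDecayRate distK (X_t ·) B′ κ θ` ∀ t, EL₂ `∀ k μ ν z z′, ∃ s, X_t k (e(ẑ_t,μ)) (e(ẑ′_t,ν)) → s`; the LETTER of `o : Option (List σ)`
is `o.elim (c_k⁻¹) (w ↦ X_{w,k})`; the DIAGRAM of `ℓ : List (Option (List σ))` is `(ℓ.map letter).prod`; no definition introduced):
* §1 (any `side t → ∞`) `tendsto_one_unit_pair`; **`list_prod_inputs`** (`d ≥ 2`: INPUTS of every member of a list `l` ⟹ INPUTS of `l.prod`); **`sum_inputs`** (INPUTS of `D_j`, `j ∈ s`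
  ⟹ INPUTS of `Σ_{j ∈ s} a_j • D_j`).
* §2 (`d ≥ 3`, `L ≥ 2`, `a > 0`, even cubic volumes `2(t+1)`, `σ` non-empty, a family `V_{i,t}` of volume-indexed Lipschitz backgrounds with common `(α, β)` DISPLAYING ONLY EL₁)
  `letter_inputs`, **`diagram_inputs`** (EVERY diagram `ℓ`), **`diagramSum_inputs`**; **`conv_diagram_of_tendsto_background`**, **`conv_diagramSum_of_tendsto_background`** (`μ ≠ ν`:
  `∃ κ > 0, B, B′ ≥ 0, Π` with `IsInfiniteVolumeLimit`, `UniformDecay Π μ ν B (κ∕d)`, `StepRate Π μ ν B′ (κ∕d) (√(L⁻¹))`, `KernelInputs d Π`,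
  `∀ k, |secondMoment (Π k) μ ν − secondMoment (limKernelOf Π) μ ν| ≤ β′_d(B′∕(1−√(L⁻¹)), κ∕d)·(√(L⁻¹))^k` — for EVERY diagram and EVERY finite linear combination of diagrams).
WHAT IT DOES NOT DO: the Faà di Bruno identity itself (which signed combination is `∂^n_{w}Σ_k|₀`); `U ≠ 1` base points (`t₀ ≠ 0`); `d ≤ 2` ∕ odd volumes; Bałaban's `Π⁰_{k+1}` ∕ shaped
`P_B` (row an1's dictionary).  SUPPLIER work; NEVER «G-an2-4 closed»; NOT (CONV-C), NOT D1, NOT `BetaPertH`, NOT continuum, NOT Clay.  Records: `HOME/b2b-balaban-gan24-p3/gen56/README.md`.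
-/

noncomputable section

open scoped BigOperators ComplexConjugate Matrix Matrix.Norms.L2Operator
open Filter Topology

namespace Summit.QuantumFields.BalabanUV.Beta.GAN24.BackgroundExpansionAllOrders

open Literature.MathematicalPhysics.QuantumFieldTheory.Balaban1983to89
open Literature.MathematicalPhysics.QuantumFieldTheory.Balaban1983to89.B5G183RateUnitTower (lev)
open Literature.MathematicalPhysics.QuantumFieldTheory.Balaban1983to89.B12Sec2to5 (betaPrime510)
open Literature.MathematicalPhysics.QuantumFieldTheory.Balaban1983to89.Beta (Site IsInfiniteVolumeLimit)
open Literature.MathematicalPhysics.QuantumFieldTheory.Balaban1983to89.Beta.FreeLegDictionary (cubic)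
open Literature.MathematicalPhysics.QuantumFieldTheory.Balaban1983to89.Beta.BlockKernelVolumeSockets (evenPeriod tendsto_evenPeriod)
open Literature.MathematicalPhysics.QuantumFieldTheory.Balaban1983to89.Beta.VectorTails (castT)
open Literature.MathematicalPhysics.QuantumFieldTheory.Balaban1983to89.Beta.LimitRate (StepRate limKernelOf KernelInputs)
open Summit.QuantumFields.BalabanUV.T4Continuum
open Summit.QuantumFields.BalabanUV.T4Continuum.CovariantAveragingTower (avgTow)
open Summit.QuantumFields.BalabanUV.T4Continuum.BalabanAveragedTowerUnit (idx QBlev calGlev unitCovB)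
open Summit.QuantumFields.BalabanUV.T4Continuum.BalabanAveragedCoerciveTower (unitIdx)
open Summit.QuantumFields.BalabanUV.T4Continuum.FirstOrderBackgroundModel (LipschitzBackground Pmodel)
open Summit.QuantumFields.BalabanUV.T4Continuum.CTKingTowerWeights (distK)
open Summit.QuantumFields.BalabanUV.T4Continuum.DecayRateInterpolation (EntryDecay TwoLevelDecayRate)
open Summit.QuantumFields.BalabanUV.Beta.GAN24.DiagramDecayAlgebra (entryDecay_add twoLevelDecayRate_add twoLevelDecayRate_smul twoLevelDecayRate_const)
open Summit.QuantumFields.BalabanUV.Beta.GAN24.UnitLatticeDecayAlgebra (distK_nonneg distK_self entryDecay_smul entryDecay_one)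
open Summit.QuantumFields.BalabanUV.Beta.GAN24.DiagramVolumeLimit (conv_of_decay_of_tendsto)
open Summit.QuantumFields.BalabanUV.Beta.GAN24.DiagramVolumeLimitSandwich (invCov_inputs)
open Summit.QuantumFields.BalabanUV.Beta.GAN24.ConstantBackgroundVolumeLimit (eventually_castT_eq_iff)
open Summit.QuantumFields.BalabanUV.Beta.GAN24.InsertionChainVolumeLimit (mul_inputs inputs_of_le_rate)
open Summit.QuantumFields.BalabanUV.Beta.GAN24.InsertionWordVolumeLimit (wordInsertion_inputs)

variable {d : ℕ} (L : ℕ) [NeZero L] (a : ℝ) (ha : 0 < a)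

/-! ## §1 The INPUT triple is closed under finite products and finite linear combinations -/

section Closure

variable {side : ℕ → ℕ} [∀ t, NeZero (side t)]

omit [NeZero L] in
/-- the readings of the IDENTITY tower at two fixed unit-lattice integer points converge (eventually the Kronecker delta of the points; PART 148's `eventually_castT_eq_iff` through
`e = unitIdx⁻¹`): the empty diagram. [folklore] -/
theorem tendsto_one_unit_pair (hside : Tendsto side atTop atTop) (μ ν : Fin d) (z z' : Fin d → ℤ) :
    ∃ s : ℂ, Tendsto (fun t => (1 : Matrix (idx L (cubic d (side t)) 0) (idx L (cubic d (side t)) 0) ℂ)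
      ((unitIdx L (cubic d (side t))).symm (castT (cubic d (side t)) z, μ)) ((unitIdx L (cubic d (side t))).symm (castT (cubic d (side t)) z', ν))) atTop (𝓝 s) := by
  classical
  refine ⟨if z = z' ∧ μ = ν then 1 else 0, tendsto_const_nhds.congr' ?_⟩
  filter_upwards [eventually_castT_eq_iff (d := d) hside z z'] with t ht
  by_cases h : z = z' ∧ μ = ν
  · rw [if_pos h]
    obtain ⟨rfl, rfl⟩ := h
    exact (Matrix.one_apply_eq _).symm
  · rw [if_neg h]
    refine (Matrix.one_apply_ne fun e => h ?_).symm
    have e' := (unitIdx L (cubic d (side t))).symm.injective e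
    exact ⟨ht.mp (congrArg Prod.fst e'), congrArg Prod.snd e'⟩

/-- **`list_prod_inputs` — THE INPUT TRIPLE IS CLOSED UNDER FINITE PRODUCTS** [folklore] (`d ≥ 2`, `side t → ∞`, `θ ≥ 0`): if every member `X` of a list `l` of tower families has INPUTS
(its own `κ_X > 0`, `B_X, B_X′ ≥ 0`), then the pointwise product `l.prod` (`(l.prod)_t k = Π_{X ∈ l} X_t k` in the list's order) has INPUTS — PART 156's `mul_inputs` by induction on
`l` at the minimum rate (halved at each step); the empty product is the identity tower (`entryDecay_one`, `twoLevelDecayRate_const`, `tendsto_one_unit_pair`). -/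
theorem list_prod_inputs (hd : 2 ≤ d) (hside : Tendsto side atTop atTop) {θ : ℝ} (hθ : 0 ≤ θ)
    (l : List ((t : ℕ) → ℕ → Matrix (idx L (cubic d (side t)) 0) (idx L (cubic d (side t)) 0) ℂ))
    (hl : ∀ X ∈ l, ∃ κ B B' : ℝ, 0 < κ ∧ 0 ≤ B ∧ 0 ≤ B' ∧
      (∀ t k, EntryDecay (distK L (cubic d (side t))) (X t k) B κ) ∧
      (∀ t, TwoLevelDecayRate (distK L (cubic d (side t))) (X t) B' κ θ) ∧
      (∀ k μ ν (z z' : Fin d → ℤ), ∃ s' : ℂ, Tendsto (fun t => X t k ((unitIdx L (cubic d (side t))).symm (castT (cubic d (side t)) z, μ))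
        ((unitIdx L (cubic d (side t))).symm (castT (cubic d (side t)) z', ν))) atTop (𝓝 s'))) :
    ∃ κ B B' : ℝ, 0 < κ ∧ 0 ≤ B ∧ 0 ≤ B' ∧
      (∀ t k, EntryDecay (distK L (cubic d (side t))) (l.prod t k) B κ) ∧
      (∀ t, TwoLevelDecayRate (distK L (cubic d (side t))) (l.prod t) B' κ θ) ∧
      (∀ k μ ν (z z' : Fin d → ℤ), ∃ s' : ℂ, Tendsto (fun t => l.prod t k ((unitIdx L (cubic d (side t))).symm (castT (cubic d (side t)) z, μ))
        ((unitIdx L (cubic d (side t))).symm (castT (cubic d (side t)) z', ν))) atTop (𝓝 s')) := by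
  induction l with
  | nil =>
    refine ⟨1, 1, 0, one_pos, zero_le_one, le_rfl, fun t k => ?_, fun t => ?_, fun k μ ν z z' => ?_⟩
    · rw [List.prod_nil, Pi.one_apply, Pi.one_apply]; exact entryDecay_one (distK_self L (cubic d (side t))) 1
    · rw [List.prod_nil, Pi.one_apply]; exact twoLevelDecayRate_const 1 1 θ
    · simp only [List.prod_nil, Pi.one_apply]; exact tendsto_one_unit_pair L hside μ ν z z'
  | cons X l ih =>
    obtain ⟨hX0, hl'⟩ := List.forall_mem_cons.mp hl
    obtain ⟨κX, BX, BX', hκX, hBX, hBX', hXud, hXsr, hXel⟩ := hX0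
    obtain ⟨κY, BY, BY', hκY, hBY, hBY', hYud, hYsr, hYel⟩ := ih hl'
    have hκ₀ : 0 < min κX κY := lt_min hκX hκY
    have hX := inputs_of_le_rate L (side := side) (X := X) hBX hBX' hθ (min_le_left κX κY) hXud hXsr
    have hY := inputs_of_le_rate L (side := side) (X := l.prod) hBY hBY' hθ (min_le_right κX κY) hYud hYsr
    obtain ⟨S, hS, hud, hsr, hel⟩ := mul_inputs L hd hside (X := X) (Y := l.prod) hκ₀ hBX hX.1 hX.2 hY.1 hY.2 hXel hYel
    refine ⟨min κX κY / 2, BX * BY * (d * S), (BX' * BY + BX * BY') * (d * S), half_pos hκ₀, by positivity, by positivity,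
      fun t k => ?_, fun t => ?_, fun k μ ν z z' => ?_⟩
    · rw [List.prod_cons, Pi.mul_apply, Pi.mul_apply]; exact hud t k
    · rw [List.prod_cons, Pi.mul_apply]; exact hsr t
    · simp only [List.prod_cons, Pi.mul_apply]; exact hel k μ ν z z'

omit [NeZero L] [∀ t, NeZero (side t)] in
/-- **`sum_inputs` — THE INPUT TRIPLE IS CLOSED UNDER FINITE LINEAR COMBINATIONS** [folklore] (`side` arbitrary, `θ ≥ 0`): if every `D_j` (`j ∈ s`) has INPUTS (own constants), so does
`Σ_{j ∈ s} a_j • D_j` (PART 130 ∕ 127's `entryDecay_add ∕ _smul`, `twoLevelDecayRate_add ∕ _smul` at the minimum rate; the empty sum is the zero tower). -/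
theorem sum_inputs {θ : ℝ} (hθ : 0 ≤ θ) {J : Type*} (s : Finset J) (coef : J → ℂ)
    (D : J → (t : ℕ) → ℕ → Matrix (idx L (cubic d (side t)) 0) (idx L (cubic d (side t)) 0) ℂ)
    (hD : ∀ j ∈ s, ∃ κ B B' : ℝ, 0 < κ ∧ 0 ≤ B ∧ 0 ≤ B' ∧
      (∀ t k, EntryDecay (distK L (cubic d (side t))) (D j t k) B κ) ∧
      (∀ t, TwoLevelDecayRate (distK L (cubic d (side t))) (D j t) B' κ θ) ∧
      (∀ k μ ν (z z' : Fin d → ℤ), ∃ s' : ℂ, Tendsto (fun t => D j t k ((unitIdx L (cubic d (side t))).symm (castT (cubic d (side t)) z, μ))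
        ((unitIdx L (cubic d (side t))).symm (castT (cubic d (side t)) z', ν))) atTop (𝓝 s'))) :
    ∃ κ B B' : ℝ, 0 < κ ∧ 0 ≤ B ∧ 0 ≤ B' ∧
      (∀ t k, EntryDecay (distK L (cubic d (side t))) ((∑ j ∈ s, coef j • D j) t k) B κ) ∧
      (∀ t, TwoLevelDecayRate (distK L (cubic d (side t))) ((∑ j ∈ s, coef j • D j) t) B' κ θ) ∧
      (∀ k μ ν (z z' : Fin d → ℤ), ∃ s' : ℂ, Tendsto (fun t => (∑ j ∈ s, coef j • D j) t k ((unitIdx L (cubic d (side t))).symm (castT (cubic d (side t)) z, μ))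
        ((unitIdx L (cubic d (side t))).symm (castT (cubic d (side t)) z', ν))) atTop (𝓝 s')) := by
  classical
  induction s using Finset.induction_on with
  | empty =>
    refine ⟨1, 0, 0, one_pos, le_rfl, le_rfl, fun t k x y => ?_, fun t => ?_, fun k μ ν z z' => ⟨0, ?_⟩⟩
    · rw [Finset.sum_empty, Pi.zero_apply, Pi.zero_apply, Matrix.zero_apply, norm_zero, zero_mul]
    · rw [Finset.sum_empty, Pi.zero_apply]; exact twoLevelDecayRate_const 0 1 θ
    · simp only [Finset.sum_empty, Pi.zero_apply, Matrix.zero_apply]; exact tendsto_const_nhds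
  | insert j s hj ih =>
    have hj0 := hD j (Finset.mem_insert_self j s)
    have hs' : ∀ i ∈ s, _ := fun i hi => hD i (Finset.mem_insert_of_mem hi)
    obtain ⟨κX, BX, BX', hκX, hBX, hBX', hXud, hXsr, hXel⟩ := hj0
    obtain ⟨κY, BY, BY', hκY, hBY, hBY', hYud, hYsr, hYel⟩ := ih hs'
    have hκ₀ : 0 < min κX κY := lt_min hκX hκY
    have hX := inputs_of_le_rate L (side := side) (X := D j) hBX hBX' hθ (min_le_left κX κY) hXud hXsr
    have hY := inputs_of_le_rate L (side := side) (X := ∑ j ∈ s, coef j • D j) hBY hBY' hθ (min_le_right κX κY) hYud hYsr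
    refine ⟨min κX κY, ‖coef j‖ * BX + BY, ‖coef j‖ * BX' + BY', hκ₀, by positivity, by positivity, fun t k => ?_, fun t => ?_, fun k μ ν z z' => ?_⟩
    · rw [Finset.sum_insert hj, Pi.add_apply, Pi.add_apply, Pi.smul_apply, Pi.smul_apply]
      exact entryDecay_add (entryDecay_smul (hX.1 t k) (coef j)) (hY.1 t k)
    · rw [Finset.sum_insert hj, Pi.add_apply, Pi.smul_apply]
      exact twoLevelDecayRate_add (twoLevelDecayRate_smul (hX.2 t) (coef j)) (hY.2 t)
    · obtain ⟨sX, hsX⟩ := hXel k μ ν z z'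
      obtain ⟨sY, hsY⟩ := hYel k μ ν z z'
      refine ⟨coef j * sX + sY, ?_⟩
      simp only [Finset.sum_insert hj, Pi.add_apply, Pi.smul_apply, Matrix.add_apply, Matrix.smul_apply, smul_eq_mul]
      exact (hsX.const_mul (coef j)).add hsY

end Closure

/-! ## §2 The letters `c_k⁻¹`, `X_{w,k}`; every diagram; every finite linear combination of diagrams; the END -/

section Diagrams

variable {σ : Type*} [Nonempty σ] {α β : ℝ} {V : σ → (t : ℕ) → (k : ℕ) → Fin d → (idx L (cubic d (evenPeriod t)) k → ℂ)}

/-- INPUTS of a LETTER: `c_k⁻¹` (PART 143's `invCov_inputs`) or `X_{w,k}` (PART 159's `wordInsertion_inputs`). [our proof] -/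
theorem letter_inputs (hL : 2 ≤ L) (hd : 3 ≤ d) (hV : ∀ i t, LipschitzBackground L (cubic d (evenPeriod t)) (V i t) α β)
    (hV1 : ∀ i k (μ f : Fin d) (z : Fin d → ℤ), ∃ s : ℂ, Tendsto (fun t => V i t k μ (castT (cubic d (lev L k * evenPeriod t)) z, f)) atTop (𝓝 s))
    (o : Option (List σ)) :
    ∃ κ B B' : ℝ, 0 < κ ∧ 0 ≤ B ∧ 0 ≤ B' ∧
      (∀ t k, EntryDecay (distK L (cubic d (evenPeriod t)))
        (o.elim (fun t k => (unitCovB L (cubic d (evenPeriod t)) a ha k)⁻¹)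
          (fun w t k => avgTow (QBlev L (cubic d (evenPeriod t))) ((L : ℝ) ^ d)
            (fun k' => List.foldr (fun i N => calGlev L (cubic d (evenPeriod t)) a ha k' * Pmodel L (cubic d (evenPeriod t)) (V i t) k' * N)
              (calGlev L (cubic d (evenPeriod t)) a ha k') w) k) t k) B κ) ∧
      (∀ t, TwoLevelDecayRate (distK L (cubic d (evenPeriod t)))
        (o.elim (fun t k => (unitCovB L (cubic d (evenPeriod t)) a ha k)⁻¹)
          (fun w t k => avgTow (QBlev L (cubic d (evenPeriod t))) ((L : ℝ) ^ d)
            (fun k' => List.foldr (fun i N => calGlev L (cubic d (evenPeriod t)) a ha k' * Pmodel L (cubic d (evenPeriod t)) (V i t) k' * N)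
              (calGlev L (cubic d (evenPeriod t)) a ha k') w) k) t) B' κ (Real.sqrt ((L : ℝ)⁻¹))) ∧
      (∀ k μ ν (z z' : Fin d → ℤ), ∃ s' : ℂ, Tendsto (fun t =>
        o.elim (fun t k => (unitCovB L (cubic d (evenPeriod t)) a ha k)⁻¹)
          (fun w t k => avgTow (QBlev L (cubic d (evenPeriod t))) ((L : ℝ) ^ d)
            (fun k' => List.foldr (fun i N => calGlev L (cubic d (evenPeriod t)) a ha k' * Pmodel L (cubic d (evenPeriod t)) (V i t) k' * N)
              (calGlev L (cubic d (evenPeriod t)) a ha k') w) k) t k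
        ((unitIdx L (cubic d (evenPeriod t))).symm (castT (cubic d (evenPeriod t)) z, μ)) ((unitIdx L (cubic d (evenPeriod t))).symm (castT (cubic d (evenPeriod t)) z', ν)))
        atTop (𝓝 s')) := by
  cases o with
  | none =>
    obtain ⟨κ, B, B', hκ, hB, hB', hud, hsr, hel⟩ := invCov_inputs L a ha hL hd
    exact ⟨κ, B, B', hκ, hB, hB', fun t k => hud (evenPeriod t) k, fun t => hsr (evenPeriod t), hel⟩
  | some w =>
    obtain ⟨κ, B, B', hκ, hB, hB', hud, hsr, hel⟩ := wordInsertion_inputs L a ha hL hd hV hV1 w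
    exact ⟨κ, B, B', hκ, hB, hB', hud, hsr, hel⟩

/-- **`diagram_inputs` — EVERY DIAGRAM HAS THE INPUT TRIPLE** [our proof] (`L ≥ 2`, `d ≥ 3`, even cubic volumes; EL₁ of the backgrounds DISPLAYED): for every `ℓ : List (Option (List σ))`
the pointwise product of its letters (`none ↦ c_k⁻¹`, `some w ↦ X_{w,k}`) has INPUTS — `list_prod_inputs` on `letter_inputs`. -/
theorem diagram_inputs (hL : 2 ≤ L) (hd : 3 ≤ d) (hV : ∀ i t, LipschitzBackground L (cubic d (evenPeriod t)) (V i t) α β)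
    (hV1 : ∀ i k (μ f : Fin d) (z : Fin d → ℤ), ∃ s : ℂ, Tendsto (fun t => V i t k μ (castT (cubic d (lev L k * evenPeriod t)) z, f)) atTop (𝓝 s))
    (ℓ : List (Option (List σ))) :
    ∃ κ B B' : ℝ, 0 < κ ∧ 0 ≤ B ∧ 0 ≤ B' ∧
      (∀ t k, EntryDecay (distK L (cubic d (evenPeriod t)))
        ((ℓ.map fun o => o.elim (fun t k => (unitCovB L (cubic d (evenPeriod t)) a ha k)⁻¹)
          (fun w t k => avgTow (QBlev L (cubic d (evenPeriod t))) ((L : ℝ) ^ d)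
            (fun k' => List.foldr (fun i N => calGlev L (cubic d (evenPeriod t)) a ha k' * Pmodel L (cubic d (evenPeriod t)) (V i t) k' * N)
              (calGlev L (cubic d (evenPeriod t)) a ha k') w) k)).prod t k) B κ) ∧
      (∀ t, TwoLevelDecayRate (distK L (cubic d (evenPeriod t)))
        ((ℓ.map fun o => o.elim (fun t k => (unitCovB L (cubic d (evenPeriod t)) a ha k)⁻¹)
          (fun w t k => avgTow (QBlev L (cubic d (evenPeriod t))) ((L : ℝ) ^ d)
            (fun k' => List.foldr (fun i N => calGlev L (cubic d (evenPeriod t)) a ha k' * Pmodel L (cubic d (evenPeriod t)) (V i t) k' * N)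
              (calGlev L (cubic d (evenPeriod t)) a ha k') w) k)).prod t) B' κ (Real.sqrt ((L : ℝ)⁻¹))) ∧
      (∀ k μ ν (z z' : Fin d → ℤ), ∃ s' : ℂ, Tendsto (fun t =>
        (ℓ.map fun o => o.elim (fun t k => (unitCovB L (cubic d (evenPeriod t)) a ha k)⁻¹)
          (fun w t k => avgTow (QBlev L (cubic d (evenPeriod t))) ((L : ℝ) ^ d)
            (fun k' => List.foldr (fun i N => calGlev L (cubic d (evenPeriod t)) a ha k' * Pmodel L (cubic d (evenPeriod t)) (V i t) k' * N)
              (calGlev L (cubic d (evenPeriod t)) a ha k') w) k)).prod t k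
        ((unitIdx L (cubic d (evenPeriod t))).symm (castT (cubic d (evenPeriod t)) z, μ)) ((unitIdx L (cubic d (evenPeriod t))).symm (castT (cubic d (evenPeriod t)) z', ν)))
        atTop (𝓝 s')) := by
  have hd2 : 2 ≤ d := le_trans (by norm_num) hd
  refine list_prod_inputs L hd2 tendsto_evenPeriod (Real.sqrt_nonneg _) _ fun X hX => ?_
  obtain ⟨o, -, rfl⟩ := List.mem_map.mp hX
  exact letter_inputs L a ha hL hd hV hV1 o

/-- **`diagramSum_inputs` — EVERY FINITE LINEAR COMBINATION OF DIAGRAMS HAS THE INPUT TRIPLE** [our proof]: `sum_inputs` on `diagram_inputs`. -/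
theorem diagramSum_inputs (hL : 2 ≤ L) (hd : 3 ≤ d) (hV : ∀ i t, LipschitzBackground L (cubic d (evenPeriod t)) (V i t) α β)
    (hV1 : ∀ i k (μ f : Fin d) (z : Fin d → ℤ), ∃ s : ℂ, Tendsto (fun t => V i t k μ (castT (cubic d (lev L k * evenPeriod t)) z, f)) atTop (𝓝 s))
    {J : Type*} (s : Finset J) (coef : J → ℂ) (ℓ : J → List (Option (List σ))) :
    ∃ κ B B' : ℝ, 0 < κ ∧ 0 ≤ B ∧ 0 ≤ B' ∧
      (∀ t k, EntryDecay (distK L (cubic d (evenPeriod t)))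
        ((∑ j ∈ s, coef j • ((ℓ j).map fun o => o.elim (fun t k => (unitCovB L (cubic d (evenPeriod t)) a ha k)⁻¹)
          (fun w t k => avgTow (QBlev L (cubic d (evenPeriod t))) ((L : ℝ) ^ d)
            (fun k' => List.foldr (fun i N => calGlev L (cubic d (evenPeriod t)) a ha k' * Pmodel L (cubic d (evenPeriod t)) (V i t) k' * N)
              (calGlev L (cubic d (evenPeriod t)) a ha k') w) k)).prod) t k) B κ) ∧
      (∀ t, TwoLevelDecayRate (distK L (cubic d (evenPeriod t)))
        ((∑ j ∈ s, coef j • ((ℓ j).map fun o => o.elim (fun t k => (unitCovB L (cubic d (evenPeriod t)) a ha k)⁻¹)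
          (fun w t k => avgTow (QBlev L (cubic d (evenPeriod t))) ((L : ℝ) ^ d)
            (fun k' => List.foldr (fun i N => calGlev L (cubic d (evenPeriod t)) a ha k' * Pmodel L (cubic d (evenPeriod t)) (V i t) k' * N)
              (calGlev L (cubic d (evenPeriod t)) a ha k') w) k)).prod) t) B' κ (Real.sqrt ((L : ℝ)⁻¹))) ∧
      (∀ k μ ν (z z' : Fin d → ℤ), ∃ s' : ℂ, Tendsto (fun t =>
        (∑ j ∈ s, coef j • ((ℓ j).map fun o => o.elim (fun t k => (unitCovB L (cubic d (evenPeriod t)) a ha k)⁻¹)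
          (fun w t k => avgTow (QBlev L (cubic d (evenPeriod t))) ((L : ℝ) ^ d)
            (fun k' => List.foldr (fun i N => calGlev L (cubic d (evenPeriod t)) a ha k' * Pmodel L (cubic d (evenPeriod t)) (V i t) k' * N)
              (calGlev L (cubic d (evenPeriod t)) a ha k') w) k)).prod) t k
        ((unitIdx L (cubic d (evenPeriod t))).symm (castT (cubic d (evenPeriod t)) z, μ)) ((unitIdx L (cubic d (evenPeriod t))).symm (castT (cubic d (evenPeriod t)) z', ν)))
        atTop (𝓝 s')) :=
  sum_inputs L (Real.sqrt_nonneg _) s coef _ fun j _ => diagram_inputs L a ha hL hd hV hV1 (ℓ j)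

/-- **`conv_diagramSum_of_tendsto_background` — THE BACKGROUND EXPANSION OF THE EFFECTIVE FORM TO ALL ORDERS, ON `ℤ^d`, MODULO ONLY THE BACKGROUNDS' POINTWISE LIMITS** [our proof]
(`d ≥ 3`, `L ≥ 2`, `a > 0`, `μ ≠ ν`, even cubic volumes `2(t+1)`, `σ` non-empty; a family `V_{i,t}` of volume-indexed Lipschitz backgrounds with common `(α, β)` DISPLAYING ONLY EL₁):
EVERY finite `ℂ`-linear combination `Σ_{j ∈ s} a_j • Π_{o ∈ ℓ_j} letter(o)` of diagrams in the letters `c_k⁻¹` and `X_{w,k}` (any words `w`) has `∃ κ > 0, B, B′ ≥ 0, Π` with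
`IsInfiniteVolumeLimit`, `UniformDecay Π μ ν B (κ∕d)`, `StepRate Π μ ν B′ (κ∕d) (√(L⁻¹))`, `KernelInputs d Π`, `∀ k, |secondMoment (Π k) μ ν − secondMoment (limKernelOf Π) μ ν| ≤
β′_d(B′∕(1−√(L⁻¹)), κ∕d)·(√(L⁻¹))^k` — `diagramSum_inputs` + PART 140's generic END.  Every mixed Taylor coefficient `∂_{t_{i₁}}⋯∂_{t_{i_n}}Σ_k(t)|₀` of `Σ_k(t) = c_k(t)⁻¹ − a″1` is such a
combination (PART 157: `Σ̈_k = 2·[none, some [i], none, some [i], none] − 2·[none, some [i,i], none]`). [cite: Balaban1987RG1, (1.21)–(1.22) p.264 (shapes)] -/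
theorem conv_diagramSum_of_tendsto_background (hL : 2 ≤ L) (hd : 3 ≤ d) {μ ν : Fin d} (hne : μ ≠ ν)
    (hV : ∀ i t, LipschitzBackground L (cubic d (evenPeriod t)) (V i t) α β)
    (hV1 : ∀ i k (μ f : Fin d) (z : Fin d → ℤ), ∃ s : ℂ, Tendsto (fun t => V i t k μ (castT (cubic d (lev L k * evenPeriod t)) z, f)) atTop (𝓝 s))
    {J : Type*} (s : Finset J) (coef : J → ℂ) (ℓ : J → List (Option (List σ))) :
    ∃ κ B B' : ℝ, 0 < κ ∧ 0 ≤ B ∧ 0 ≤ B' ∧ ∃ Pinf : ℕ → B12Beta.Kernel d,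
      (∀ k, IsInfiniteVolumeLimit evenPeriod
        (fun t μ' ν' (z : Site d (evenPeriod t)) =>
          ((∑ j ∈ s, coef j • ((ℓ j).map fun o => o.elim (fun t k => (unitCovB L (cubic d (evenPeriod t)) a ha k)⁻¹)
            (fun w t k => avgTow (QBlev L (cubic d (evenPeriod t))) ((L : ℝ) ^ d)
              (fun k' => List.foldr (fun i N => calGlev L (cubic d (evenPeriod t)) a ha k' * Pmodel L (cubic d (evenPeriod t)) (V i t) k' * N)
                (calGlev L (cubic d (evenPeriod t)) a ha k') w) k)).prod) t k
          ((unitIdx L (cubic d (evenPeriod t))).symm (z, μ')) ((unitIdx L (cubic d (evenPeriod t))).symm (0, ν'))).re) (Pinf k)) ∧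
      Beta.LimitRate.UniformDecay Pinf μ ν B (κ / d) ∧ StepRate Pinf μ ν B' (κ / d) (Real.sqrt ((L : ℝ)⁻¹)) ∧
      (∃ K : KernelInputs d Pinf, K.θ = Real.sqrt ((L : ℝ)⁻¹) ∧ K.c₀ = betaPrime510 d (B' / (1 - Real.sqrt ((L : ℝ)⁻¹))) (κ / d) ∧ K.Pinf = limKernelOf Pinf ∧ K.μ = μ ∧ K.ν = ν) ∧
      (∀ k, |B12Beta.secondMoment (Pinf k) μ ν - B12Beta.secondMoment (limKernelOf Pinf) μ ν|
          ≤ betaPrime510 d (B' / (1 - Real.sqrt ((L : ℝ)⁻¹))) (κ / d) * Real.sqrt ((L : ℝ)⁻¹) ^ k) := by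
  have hd1 : 1 ≤ d := le_trans (by norm_num) hd
  have hL1 : (1 : ℝ) < L := by exact_mod_cast (lt_of_lt_of_le one_lt_two hL : 1 < L)
  have hθ1 : Real.sqrt ((L : ℝ)⁻¹) < 1 := by
    rw [show (1 : ℝ) = Real.sqrt 1 from Real.sqrt_one.symm]
    exact Real.sqrt_lt_sqrt (inv_nonneg.mpr (Nat.cast_nonneg _)) (inv_lt_one_of_one_lt₀ hL1)
  obtain ⟨κ, B, B', hκ, hB, hB', hud, hsr, hel⟩ := diagramSum_inputs L a ha hL hd hV hV1 s coef ℓ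
  have hlim := fun k (μ' ν' : Fin d) (z : Fin d → ℤ) => by
    have h := hel k μ' ν' z 0
    have e0 : ∀ t, castT (cubic d (evenPeriod t)) (0 : Fin d → ℤ) = 0 := fun t => by funext i; simp [castT]
    simp only [e0] at h
    exact h
  obtain ⟨Pinf, hP⟩ := conv_of_decay_of_tendsto L hd1 tendsto_evenPeriod hκ (Real.sqrt_nonneg _) hθ1 hud hsr hlim hne
  exact ⟨κ, B, B', hκ, hB, hB', Pinf, hP⟩

/-- **`conv_diagram_of_tendsto_background`** — the same END for ONE diagram `ℓ` (the combination over `{ℓ}` with coefficient `1`). [our proof] -/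
theorem conv_diagram_of_tendsto_background (hL : 2 ≤ L) (hd : 3 ≤ d) {μ ν : Fin d} (hne : μ ≠ ν)
    (hV : ∀ i t, LipschitzBackground L (cubic d (evenPeriod t)) (V i t) α β)
    (hV1 : ∀ i k (μ f : Fin d) (z : Fin d → ℤ), ∃ s : ℂ, Tendsto (fun t => V i t k μ (castT (cubic d (lev L k * evenPeriod t)) z, f)) atTop (𝓝 s))
    (ℓ : List (Option (List σ))) :
    ∃ κ B B' : ℝ, 0 < κ ∧ 0 ≤ B ∧ 0 ≤ B' ∧ ∃ Pinf : ℕ → B12Beta.Kernel d,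
      (∀ k, IsInfiniteVolumeLimit evenPeriod
        (fun t μ' ν' (z : Site d (evenPeriod t)) =>
          ((ℓ.map fun o => o.elim (fun t k => (unitCovB L (cubic d (evenPeriod t)) a ha k)⁻¹)
            (fun w t k => avgTow (QBlev L (cubic d (evenPeriod t))) ((L : ℝ) ^ d)
              (fun k' => List.foldr (fun i N => calGlev L (cubic d (evenPeriod t)) a ha k' * Pmodel L (cubic d (evenPeriod t)) (V i t) k' * N)
                (calGlev L (cubic d (evenPeriod t)) a ha k') w) k)).prod t k
          ((unitIdx L (cubic d (evenPeriod t))).symm (z, μ')) ((unitIdx L (cubic d (evenPeriod t))).symm (0, ν'))).re) (Pinf k)) ∧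
      Beta.LimitRate.UniformDecay Pinf μ ν B (κ / d) ∧ StepRate Pinf μ ν B' (κ / d) (Real.sqrt ((L : ℝ)⁻¹)) ∧
      (∃ K : KernelInputs d Pinf, K.θ = Real.sqrt ((L : ℝ)⁻¹) ∧ K.c₀ = betaPrime510 d (B' / (1 - Real.sqrt ((L : ℝ)⁻¹))) (κ / d) ∧ K.Pinf = limKernelOf Pinf ∧ K.μ = μ ∧ K.ν = ν) ∧
      (∀ k, |B12Beta.secondMoment (Pinf k) μ ν - B12Beta.secondMoment (limKernelOf Pinf) μ ν|
          ≤ betaPrime510 d (B' / (1 - Real.sqrt ((L : ℝ)⁻¹))) (κ / d) * Real.sqrt ((L : ℝ)⁻¹) ^ k) := by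
  have hd1 : 1 ≤ d := le_trans (by norm_num) hd
  have hL1 : (1 : ℝ) < L := by exact_mod_cast (lt_of_lt_of_le one_lt_two hL : 1 < L)
  have hθ1 : Real.sqrt ((L : ℝ)⁻¹) < 1 := by
    rw [show (1 : ℝ) = Real.sqrt 1 from Real.sqrt_one.symm]
    exact Real.sqrt_lt_sqrt (inv_nonneg.mpr (Nat.cast_nonneg _)) (inv_lt_one_of_one_lt₀ hL1)
  obtain ⟨κ, B, B', hκ, hB, hB', hud, hsr, hel⟩ := diagram_inputs L a ha hL hd hV hV1 ℓ
  have hlim := fun k (μ' ν' : Fin d) (z : Fin d → ℤ) => by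
    have h := hel k μ' ν' z 0
    have e0 : ∀ t, castT (cubic d (evenPeriod t)) (0 : Fin d → ℤ) = 0 := fun t => by funext i; simp [castT]
    simp only [e0] at h
    exact h
  obtain ⟨Pinf, hP⟩ := conv_of_decay_of_tendsto L hd1 tendsto_evenPeriod hκ (Real.sqrt_nonneg _) hθ1 hud hsr hlim hne
  exact ⟨κ, B, B', hκ, hB, hB', Pinf, hP⟩

end Diagrams

end Summit.QuantumFields.BalabanUV.Beta.GAN24.BackgroundExpansionAllOrders

end
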